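import Summits.QuantumFields.BalabanUV.Beta.FP.GhostLoopCountingMix
import Summits.QuantumFields.BalabanUV.Beta.FP.MixLoopPowerCountingMassQuartic

/-!
# `Beta/FP/GhostLoopCountingMixQuartic` — road «FP» (binder row D1), organisation γ, row **(GH-a) COUNTING, piece (g4)** «the four scalar constraint loops in MIX
# mass currency»: THE (MIX-4) ENGINE AT THE 0-FORM ROOTED BLOCK FAMILY AND THE SCALAR MINIMISER's COLUMNS — sibling of `FP/GhostLoopCountingMix` ((MIX-2)); the second
# averaging jet `ker₂` of `ScalarAveragingJetLetters`, the pair weight read off ONE radial word, the (M₂) letter, and the END `ghost_mix4_rem` with every power of `N`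
# DISPLAYED ([folklore] index plumbing on `ℤ⁴`; no road object identified)

HONEST FRAMING (cell `pub-balaban`, β sub-cell, verbatim): discharging `BetaPertH` makes Bałaban's UV stability UNCONDITIONAL — a real constructive-QFT
result; it is NOT the continuum limit and NOT the Clay problem.  THIS MODULE is [folklore] finite-sum plumbing composed BY NAME with ACCEPTED tree theorems of this
road: `MixLoopPowerCountingMassQuartic.coarse_mix4_secondMoment_le` (t4-ne7b-formalise-leaf-01-g23, RHOA-6c′ (MIX-4)), `AveragingJetLettersRootedSecond`
(`ker₂`, `exists_of_ker₂_ne_zero`, `sum_ker₂_outer_le`; t4-ne7b-formalise-leaf-02-g22), this lineage's 0-form family `ScalarAveragingJetLetters` (`sclW`∕`sclFld`∕`sclBg`,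
`scl_windowedMass_le_half`, `length_sclBg_le`) and `GhostLoopCountingMix.ghostColumn_engineLetters` (the (I-gh) letters of `ScalarMinimiserLettersPt` packaged).  It
asserts nothing about Bałaban's objects, cites nothing, mints no `Prop` fact, has no `def`, 0 sorry.  NOT the identification of `T₄^{gh}` with the K_n-ghost's (MIX-4)
term `tr(𝓘Q̈′)` (KER-γ (α)'s dictionary), NOT the instance number (KER-γ (γ) ∕ LEDGER), NOT (MIX-1)∕(MIX-3), NOT (GH-a) as a whole, NOT `Mix_n = O(1)`, NOT hbook,
NOT D1, NOT BetaPertH, NOT continuum, NOT Clay.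
HONEST DEPENDENCY: continuum YM on T⁴ ⇐ BetaPertH ∧ nine spine estimates (0/9 proved); BetaPertH ⇐ (D1) ∧ (D4) ∧ CAP+tail; G-an2-4 gates asym, D1 and NE2/3/4.

ABSOLUTE RULE (cell charter, verbatim): «No internally-minted statement may enter as a cited fact. Every hypothesis is either kernel-proved in this package or a
verbatim quotation of a PUBLISHED theorem with page reference. The manuscript(s) under audit are NOT citable for their own disputed steps — they are the thing under
adjudication; programme-internal (2001/route/tribunal) claims are never citable.»

THE ROW (road-FP OWNER b2b-balaban-beta-d1-p3, `LEAVES-FP.md` row (GH-a) COUNTING (R-FP-28 (d)), piece (g4); R-FP-26 (b) ∕ `ROOTING-MIX.md` §2 (ii) «(MIX-4)'s 4-jet: the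
rooted second-order words have the same length letter ℓ, mass ≤ ℓ²·(norm) per coarse site»).  BINDING CHECK (R-FP-28 (d), displayed): NO lattice difference; smallness is
pair-mass × column counting only, exactly the engine's (MIX-4) shape.  CURRENCY: as in `GhostLoopCountingMix` (point labels, free radial rules with the length letter `ℓ₀`
and the ℕ-valued radius letter «`ℓ ∈ rad σ u x′` ⟹ `‖ℓ − N•u‖∞ ≤ R₀·N`», free probabilities `p σ ≥ 0`, free `a > 0`).

CONTENT.  `pairWeight_le_of_ker₂_ne_zero` (both letters on one radial word ⟹ `1 + (‖b′−b‖∞∕N)² ≤ 1 + 4R₀²`), **`windowedPairMass_scl_le`** ((M₂) for the engine's pair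
mass `M₂(b,b′) = Σ_{u∈U b}Σ_{w∈W}|ker₂^{(u)} b b′ (b+w)|`, ANY `U`, `W`: `≤ (1+4R₀²)·(2ℓ₀·(ℓ₀·Σp))·e^{δR₀∕2}·(e^{δ∕2}(1+480e^{δ∕4}(4∕δ)⁴))`), **`coarse_mix4_secondMoment_scl`**
(abstract legs under (I₀)(J)(J′)), THE END **`ghost_mix4_rem`**: `Σ_{v∈V}‖v−v₀‖∞²·|Σ_{b,b′∈S} 𝓘_gh(b,v₀)·𝓘_gh(b′,v)·Σ_{u∈U b}Σ_{w∈W} ker₂^{(u)} b b′ (b+w)·𝓘_gh(b+w,u)|`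
`≤ 3·C·C′·(1+16∕δ²)·(C·((1+4R₀²)·(2ℓ₀·(ℓ₀·Σ_σ p σ))·e^{δR₀∕2}·(…)))`, `δ = deltaH 4 1` — EVERY power of `N` displayed: `N⁰·ℓ₀²·Σp` times numbers; n-free iff `ℓ₀²·Σ_σ p σ ≲ 1`
AFTER the LEDGER fixes `Q′`'s normalisation against `𝓘_gh`'s — displayed, not decided (KER-γ (γ)).
Provenance: D1 formalisation swarm, unit `b2b-balaban-beta-d1-formalise-leaf-05` gen 14 (prover-…-leaf-05-g14-0), 2026-08-21, first refusal on (GH-a) (g4) exercised (journal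
INTENT 2026-08-21T03:56:26Z); «not in print; our bookkeeping»; no existing file touched.
-/

noncomputable section

namespace Summit.QuantumFields.BalabanUV.Beta.FP.GhostLoopCountingMixQuartic

open Finset Real
open scoped BigOperators
open Literature.MathematicalPhysics.QuantumFieldTheory.Balaban1983to89
open Literature.MathematicalPhysics.QuantumFieldTheory.Balaban1983to89.Beta
open DyadicShell (Pt supNorm)
open BlockLegs (supNorm_sub_le_real)
open AxialBlockWeights (fineBlock)
open B5Hk103ScalarZd (kerH deltaH deltaH_pos)
open Summit.QuantumFields.BalabanUV.Beta.FP.AveragingJetLettersRooted (mass₁ mass₁_nonneg)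
open Summit.QuantumFields.BalabanUV.Beta.FP.AveragingJetLettersRootedSecond (ker₂ ker₂_nonneg exists_of_ker₂_ne_zero sum_ker₂_outer_le)
open Summit.QuantumFields.BalabanUV.Beta.FP.ScalarAveragingJetLetters
  (sclW sclFld sclBg sclW_nonneg scl_windowedMass_le_half length_sclBg_le)
open Summit.QuantumFields.BalabanUV.Beta.FP.MixLoopPowerCountingMassQuartic (coarse_mix4_secondMoment_le)
open Summit.QuantumFields.BalabanUV.Beta.FP.GhostLoopCountingMix (ghostColumn_engineLetters)

/-! ## §1 The pair weight off one radial word and the (M₂) letter -/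

section Quartic

variable {σ : Type*} [Fintype σ] {N : ℕ} {p : σ → ℝ} {rad : σ → Pt → Pt → List Pt} {ℓ₀ R₀ : ℕ}

/-- [folklore] **THE PAIR WEIGHT READ OFF ONE RADIAL WORD**: a nonzero `ker₂^{(u)} b b′ c` puts BOTH letters on one radial word of block `u`, hence both within `R₀·N` of
`N•u`, so `‖b′ − b‖∞ ≤ 2R₀N` and `1 + (‖b′−b‖∞∕N)² ≤ 1 + 4R₀²` (`N ≥ 1`). -/
theorem pairWeight_le_of_ker₂_ne_zero (hN : 1 ≤ N)
    (hradR : ∀ (s : σ) (u : Pt) (x : ↥(fineBlock N)) (ℓ : Pt), ℓ ∈ rad s u x.1 → supNorm (ℓ - (N : ℤ) • u) ≤ R₀ * N)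
    {u b b' c : Pt} (h : ker₂ (sclW N p) (sclFld N u) (sclBg N u rad) b b' c ≠ 0) :
    1 + ((supNorm (b' - b) : ℝ) / N) ^ 2 ≤ 1 + 4 * (R₀ : ℝ) ^ 2 := by
  obtain ⟨e, _, hb, hb'⟩ := exists_of_ker₂_ne_zero h
  have h1 : supNorm (b - (N : ℤ) • u) ≤ R₀ * N := hradR e.2 u e.1 b hb
  have h2 : supNorm (b' - (N : ℤ) • u) ≤ R₀ * N := hradR e.2 u e.1 b' hb'
  have hN' : (0 : ℝ) < N := by exact_mod_cast hN
  have e1 : b' - b = (b' - (N : ℤ) • u) - (b - (N : ℤ) • u) := by abel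
  have hreal : (supNorm (b' - b) : ℝ) ≤ supNorm (b' - (N : ℤ) • u) + supNorm (b - (N : ℤ) • u) := by
    rw [e1]; exact supNorm_sub_le_real _ _
  have h1' : (supNorm (b - (N : ℤ) • u) : ℝ) ≤ (R₀ : ℝ) * N := by exact_mod_cast h1
  have h2' : (supNorm (b' - (N : ℤ) • u) : ℝ) ≤ (R₀ : ℝ) * N := by exact_mod_cast h2
  have hq : (supNorm (b' - b) : ℝ) / N ≤ 2 * R₀ := by
    rw [div_le_iff₀ hN']; linarith
  have hq0 : 0 ≤ (supNorm (b' - b) : ℝ) / N := by positivity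
  nlinarith

/-- **(M₂) FOR THE ENGINE's PAIR MASS `M₂(b,b′) = Σ_{u∈U b}Σ_{w∈W}|ker₂^{(u)} b b′ (b+w)|` AT THE 0-FORM FAMILY, with the pair's own separation weight** ([folklore];
ANY coarse windows `U b`, ANY finite `W`, `S`, every coarse centre `v₀`):
`Σ_{b∈S}Σ_{b′∈S} e^{−(δ∕(2N))‖b−N•v₀‖∞}·(1+(‖b′−b‖∞∕N)²)·M₂(b,b′) ≤ (1+4R₀²)·(2ℓ₀·(ℓ₀·Σp))·e^{δR₀∕2}·(e^{δ∕2}(1+480e^{δ∕4}(4∕δ)⁴))`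
(pair weight by `pairWeight_le_of_ker₂_ne_zero`, then `sum_ker₂_outer_le` (`Σ_{b′}Σ_c ker₂ ≤ 2ℓ₀·mass₁`) and `scl_windowedMass_le_half` BY NAME). -/
theorem windowedPairMass_scl_le {δ : ℝ} (hδ : 0 < δ) (hN : 1 ≤ N) (hp : ∀ s, 0 ≤ p s)
    (hrad : ∀ s u x', (rad s u x').length ≤ ℓ₀)
    (hradR : ∀ (s : σ) (u : Pt) (x : ↥(fineBlock N)) (ℓ : Pt), ℓ ∈ rad s u x.1 → supNorm (ℓ - (N : ℤ) • u) ≤ R₀ * N)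
    (U : Pt → Finset Pt) (W S : Finset Pt) (v₀ : Pt) :
    ∑ b ∈ S, ∑ b' ∈ S, Real.exp (-(δ / (2 * N)) * (supNorm (b - (N : ℤ) • v₀) : ℝ)) *
        (1 + ((supNorm (b' - b) : ℝ) / N) ^ 2) * (∑ u ∈ U b, ∑ w ∈ W, |ker₂ (sclW N p) (sclFld N u) (sclBg N u rad) b b' (b + w)|)
      ≤ (1 + 4 * (R₀ : ℝ) ^ 2) * (((2 * ((ℓ₀ : ℕ) : ℝ)) * (((ℓ₀ : ℕ) : ℝ) * ∑ s, p s)) * Real.exp (δ * R₀ / 2) *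
          (Real.exp (δ / 2) * (1 + 480 * Real.exp (δ / 4) * (4 / δ) ^ 4))) := by
  classical
  set Y : Finset Pt := S.biUnion U with hY
  have hω := sclW_nonneg N hp
  set K : Pt → Pt → Pt → ℝ := fun u b b' => ∑ w ∈ W, ker₂ (sclW N p) (sclFld N u) (sclBg N u rad) b b' (b + w) with hK
  have hK0 : ∀ u b b', 0 ≤ K u b b' := fun u b b' => Finset.sum_nonneg fun w _ => ker₂_nonneg hω _ _ _
  -- (i) pointwise: the pair weight against the nonnegative kernel
  have hpt : ∀ u b b', (1 + ((supNorm (b' - b) : ℝ) / N) ^ 2) *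
      (∑ w ∈ W, |ker₂ (sclW N p) (sclFld N u) (sclBg N u rad) b b' (b + w)|) ≤ (1 + 4 * (R₀ : ℝ) ^ 2) * K u b b' := by
    intro u b b'
    rw [hK, Finset.mul_sum, Finset.mul_sum]
    refine Finset.sum_le_sum fun w _ => ?_
    rw [abs_of_nonneg (ker₂_nonneg hω _ _ _)]
    by_cases hz : ker₂ (sclW N p) (sclFld N u) (sclBg N u rad) b b' (b + w) = 0
    · rw [hz, mul_zero, mul_zero]
    · exact mul_le_mul_of_nonneg_right (pairWeight_le_of_ker₂_ne_zero hN hradR hz) (ker₂_nonneg hω _ _ _)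
  -- (ii) per insertion `b`: the weighted pair mass over `b′ ∈ S` is at most `(1+4R₀²)·2ℓ₀·Σ_{u∈Y} mass₁^{(u)} b`
  have hrow : ∀ b ∈ S, ∑ b' ∈ S, (1 + ((supNorm (b' - b) : ℝ) / N) ^ 2) *
      (∑ u ∈ U b, ∑ w ∈ W, |ker₂ (sclW N p) (sclFld N u) (sclBg N u rad) b b' (b + w)|)
      ≤ (1 + 4 * (R₀ : ℝ) ^ 2) * ((2 * ((ℓ₀ : ℕ) : ℝ)) * ∑ u ∈ Y, mass₁ (sclW N p) (sclBg N u rad) b) := by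
    intro b hb
    have hUb : U b ⊆ Y := by rw [hY]; exact Finset.subset_biUnion_of_mem U hb
    have hstep1 : ∑ b' ∈ S, (1 + ((supNorm (b' - b) : ℝ) / N) ^ 2) *
        (∑ u ∈ U b, ∑ w ∈ W, |ker₂ (sclW N p) (sclFld N u) (sclBg N u rad) b b' (b + w)|)
        ≤ ∑ b' ∈ S, ∑ u ∈ U b, (1 + 4 * (R₀ : ℝ) ^ 2) * K u b b' := by
      refine Finset.sum_le_sum fun b' _ => ?_
      rw [Finset.mul_sum]
      exact Finset.sum_le_sum fun u _ => hpt u b b'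
    have hstep2 : ∑ b' ∈ S, ∑ u ∈ U b, (1 + 4 * (R₀ : ℝ) ^ 2) * K u b b'
        = (1 + 4 * (R₀ : ℝ) ^ 2) * ∑ u ∈ U b, ∑ b' ∈ S, K u b b' := by
      rw [Finset.sum_comm, Finset.mul_sum]
      refine Finset.sum_congr rfl fun u _ => ?_
      rw [Finset.mul_sum]
    have hstep3 : ∀ u, ∑ b' ∈ S, K u b b' ≤ (2 * ((ℓ₀ : ℕ) : ℝ)) * mass₁ (sclW N p) (sclBg N u rad) b := by
      intro u
      have h := sum_ker₂_outer_le hω (length_sclBg_le u (hrad · u ·)) b S (W.image fun w => b + w) (fld := sclFld N u)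
      have e : ∀ b', K u b b' = ∑ c ∈ W.image (fun w => b + w), ker₂ (sclW N p) (sclFld N u) (sclBg N u rad) b b' c := by
        intro b'
        rw [hK, Finset.sum_image (fun x _ y _ h => add_left_cancel h)]
      simp only [e]
      exact h
    have hstep4 : ∑ u ∈ U b, ∑ b' ∈ S, K u b b' ≤ (2 * ((ℓ₀ : ℕ) : ℝ)) * ∑ u ∈ Y, mass₁ (sclW N p) (sclBg N u rad) b := by
      calc ∑ u ∈ U b, ∑ b' ∈ S, K u b b' ≤ ∑ u ∈ U b, (2 * ((ℓ₀ : ℕ) : ℝ)) * mass₁ (sclW N p) (sclBg N u rad) b :=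
            Finset.sum_le_sum fun u _ => hstep3 u
        _ ≤ ∑ u ∈ Y, (2 * ((ℓ₀ : ℕ) : ℝ)) * mass₁ (sclW N p) (sclBg N u rad) b :=
            Finset.sum_le_sum_of_subset_of_nonneg hUb fun u _ _ => mul_nonneg (by positivity) (mass₁_nonneg hω b)
        _ = (2 * ((ℓ₀ : ℕ) : ℝ)) * ∑ u ∈ Y, mass₁ (sclW N p) (sclBg N u rad) b := by rw [Finset.mul_sum]
    calc _ ≤ _ := hstep1
      _ = _ := hstep2
      _ ≤ _ := mul_le_mul_of_nonneg_left hstep4 (by positivity)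
  -- (iii) the window against the first-jet mass function: `scl_windowedMass_le_half` at the centre `N•v₀`
  have hradR' : ∀ (s : σ) (u : Pt) (x : ↥(fineBlock N)) (ℓ : Pt), ℓ ∈ rad s u x.1 →
      (supNorm (id ℓ - (N : ℤ) • u) : ℝ) ≤ (R₀ : ℝ) * N := by
    intro s u x ℓ h
    have h' := hradR s u x ℓ h
    rw [id]
    exact_mod_cast h'
  have hM := scl_windowedMass_le_half (B := Pt) hδ hN hp hrad id hradR' S Y ((N : ℤ) • v₀)
  simp only [id] at hM
  have hΘ : 0 ≤ Real.exp (δ * R₀ / 2) * (Real.exp (δ / 2) * (1 + 480 * Real.exp (δ / 4) * (4 / δ) ^ 4)) := by positivity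
  calc ∑ b ∈ S, ∑ b' ∈ S, Real.exp (-(δ / (2 * N)) * (supNorm (b - (N : ℤ) • v₀) : ℝ)) *
          (1 + ((supNorm (b' - b) : ℝ) / N) ^ 2) * (∑ u ∈ U b, ∑ w ∈ W, |ker₂ (sclW N p) (sclFld N u) (sclBg N u rad) b b' (b + w)|)
      = ∑ b ∈ S, Real.exp (-(δ / (2 * N)) * (supNorm (b - (N : ℤ) • v₀) : ℝ)) *
          ∑ b' ∈ S, (1 + ((supNorm (b' - b) : ℝ) / N) ^ 2) *
            (∑ u ∈ U b, ∑ w ∈ W, |ker₂ (sclW N p) (sclFld N u) (sclBg N u rad) b b' (b + w)|) := by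
        refine Finset.sum_congr rfl fun b _ => ?_
        rw [Finset.mul_sum]
        exact Finset.sum_congr rfl fun b' _ => by ring
    _ ≤ ∑ b ∈ S, Real.exp (-(δ / (2 * N)) * (supNorm (b - (N : ℤ) • v₀) : ℝ)) *
          ((1 + 4 * (R₀ : ℝ) ^ 2) * ((2 * ((ℓ₀ : ℕ) : ℝ)) * ∑ u ∈ Y, mass₁ (sclW N p) (sclBg N u rad) b)) :=
        Finset.sum_le_sum fun b hb => mul_le_mul_of_nonneg_left (hrow b hb) (Real.exp_pos _).le
    _ = (1 + 4 * (R₀ : ℝ) ^ 2) * (2 * ((ℓ₀ : ℕ) : ℝ)) *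
          ∑ b ∈ S, Real.exp (-(δ / (2 * N)) * (supNorm (b - (N : ℤ) • v₀) : ℝ)) * ∑ u ∈ Y, mass₁ (sclW N p) (sclBg N u rad) b := by
        rw [Finset.mul_sum]
        exact Finset.sum_congr rfl fun b _ => by ring
    _ ≤ (1 + 4 * (R₀ : ℝ) ^ 2) * (2 * ((ℓ₀ : ℕ) : ℝ)) *
          ((((ℓ₀ : ℕ) : ℝ) * ∑ s, p s) * Real.exp (δ * R₀ / 2) * (Real.exp (δ / 2) * (1 + 480 * Real.exp (δ / 4) * (4 / δ) ^ 4))) :=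
        mul_le_mul_of_nonneg_left hM (by positivity)
    _ = _ := by ring

/-- **THE (MIX-4) ENGINE AT THE 0-FORM FAMILY** ([folklore] plumbing; `coarse_mix4_secondMoment_le` BY NAME with `qdd u b b′ c := ker₂ (sclW N p) (sclFld N u) (sclBg N u rad) b b′ c`,
(M₂) := `windowedPairMass_scl_le`): under the sup letter (I₀) `|I c u| ≤ C_I`, (J), (J′), for ANY coarse windows `U b`, ANY finite `W`, `S`, `V`, every `v₀`:
`Σ_{v∈V}‖v−v₀‖∞²·|Σ_{b,b′∈S} J b v₀·J b′ v·Σ_{u∈U b}Σ_{w∈W} ker₂^{(u)} b b′ (b+w)·I (b+w) u| ≤ 3·C_J·C_J′·(1+16∕δ²)·(C_I·((1+4R₀²)·(2ℓ₀·(ℓ₀·Σp))·e^{δR₀∕2}·(…)))`. -/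
theorem coarse_mix4_secondMoment_scl {δ : ℝ} (hδ : 0 < δ) (hN : 1 ≤ N) (hp : ∀ s, 0 ≤ p s)
    (hrad : ∀ s u x', (rad s u x').length ≤ ℓ₀)
    (hradR : ∀ (s : σ) (u : Pt) (x : ↥(fineBlock N)) (ℓ : Pt), ℓ ∈ rad s u x.1 → supNorm (ℓ - (N : ℤ) • u) ≤ R₀ * N)
    (U : Pt → Finset Pt) (W : Finset Pt) {I J : Pt → Pt → ℝ} {C_I C_J C_J' : ℝ} (hI : ∀ c u, |I c u| ≤ C_I)
    (S V : Finset Pt) (v₀ : Pt)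
    (hJ : ∀ b, |J b v₀| ≤ C_J * Real.exp (-(δ / N) * (supNorm (b - (N : ℤ) • v₀) : ℝ)))
    (hJ' : ∀ b', ∑ v ∈ V, (1 + ((supNorm (b' - (N : ℤ) • v) : ℝ) / N) ^ 2) * |J b' v| ≤ C_J') :
    ∑ v ∈ V, (supNorm (v - v₀) : ℝ) ^ 2 *
        |∑ b ∈ S, ∑ b' ∈ S, J b v₀ * J b' v *
          (∑ u ∈ U b, ∑ w ∈ W, ker₂ (sclW N p) (sclFld N u) (sclBg N u rad) b b' (b + w) * I (b + w) u)|
      ≤ 3 * C_J * C_J' * (1 + 16 / δ ^ 2) * (C_I * ((1 + 4 * (R₀ : ℝ) ^ 2) *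
          (((2 * ((ℓ₀ : ℕ) : ℝ)) * (((ℓ₀ : ℕ) : ℝ) * ∑ s, p s)) * Real.exp (δ * R₀ / 2) *
            (Real.exp (δ / 2) * (1 + 480 * Real.exp (δ / 4) * (4 / δ) ^ 4))))) :=
  coarse_mix4_secondMoment_le (qdd := fun u b b' c => ker₂ (sclW N p) (sclFld N u) (sclBg N u rad) b b' c)
    hδ hN hI S V v₀ hJ hJ' (windowedPairMass_scl_le hδ hN hp hrad hradR U W S v₀)

end Quartic

/-! ## §2 The END -/

/-- **THE END `ghost_mix4_rem` — ROW (GH-a) PIECE (g4), THE (MIX-4) GHOST TWIN** ([our object]; `d = 4`): with `C, C′` of `ghostColumn_engineLetters`, for EVERY `a > 0`,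
`N ≥ 1`, every 0-form rooted block family at blocking `N`, ANY coarse windows `U b`, all finite `W`, `S`, `V`, every `v₀` (`𝓘_gh(c,u) := kerH (N−1) a c u`, `δ := deltaH 4 1`):
`Σ_{v∈V}‖v−v₀‖∞²·|Σ_{b,b′∈S} 𝓘_gh(b,v₀)·𝓘_gh(b′,v)·Σ_{u∈U b}Σ_{w∈W} ker₂^{(u)} b b′ (b+w)·𝓘_gh(b+w,u)|`
`≤ 3·C·C′·(1+16∕δ²)·(C·((1+4R₀²)·(2ℓ₀·(ℓ₀·Σ_σ p σ))·e^{δR₀∕2}·(e^{δ∕2}(1+480e^{δ∕4}(4∕δ)⁴))))` — EVERY power of `N` displayed: `N⁰·ℓ₀²·Σp` times numbers (the sup letter of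
`𝓘_gh` is the (I) letter at distance 0).  NOT the identification with the K_n-ghost's (MIX-4) term, NOT `Mix_n = O(1)`, NOT (GH-a), NOT hbook, NOT D1, NOT BetaPertH. -/
theorem ghost_mix4_rem :
    ∃ C C' : ℝ, 0 ≤ C ∧ 0 ≤ C' ∧ ∀ {a : ℝ}, 0 < a → ∀ (N : ℕ), 1 ≤ N →
      ∀ {σ : Type*} [Fintype σ] {p : σ → ℝ} (_ : ∀ s, 0 ≤ p s)
        {rad : σ → Pt → Pt → List Pt} {ℓ₀ R₀ : ℕ} (_ : ∀ s u x', (rad s u x').length ≤ ℓ₀)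
        (_ : ∀ (s : σ) (u : Pt) (x : ↥(fineBlock N)) (ℓ : Pt), ℓ ∈ rad s u x.1 → supNorm (ℓ - (N : ℤ) • u) ≤ R₀ * N)
        (U : Pt → Finset Pt) (W S V : Finset Pt) (v₀ : Pt),
        ∑ v ∈ V, (supNorm (v - v₀) : ℝ) ^ 2 *
            |∑ b ∈ S, ∑ b' ∈ S, kerH (N - 1) a b v₀ * kerH (N - 1) a b' v *
              (∑ u ∈ U b, ∑ w ∈ W, ker₂ (sclW N p) (sclFld N u) (sclBg N u rad) b b' (b + w) * kerH (N - 1) a (b + w) u)|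
          ≤ 3 * C * C' * (1 + 16 / deltaH 4 1 ^ 2) * (C * ((1 + 4 * (R₀ : ℝ) ^ 2) *
              (((2 * ((ℓ₀ : ℕ) : ℝ)) * (((ℓ₀ : ℕ) : ℝ) * ∑ s, p s)) * Real.exp (deltaH 4 1 * R₀ / 2) *
                (Real.exp (deltaH 4 1 / 2) * (1 + 480 * Real.exp (deltaH 4 1 / 4) * (4 / deltaH 4 1) ^ 4))))) := by
  obtain ⟨C, C', hC, hC', h⟩ := ghostColumn_engineLetters
  refine ⟨C, C', hC, hC', fun {a} ha N hN σ _ p hp rad ℓ₀ R₀ hrad hradR U W S V v₀ => ?_⟩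
  have hδ : 0 < deltaH 4 1 := deltaH_pos 4 one_pos
  obtain ⟨hI, hJ'⟩ := h ha N hN
  have hI0 : ∀ c u : Pt, |kerH (N - 1) a c u| ≤ C := by
    intro c u
    refine (hI c u).trans ?_
    have h1 : Real.exp (-(deltaH 4 1 / N) * (supNorm (c - (N : ℤ) • u) : ℝ)) ≤ 1 := by
      apply Real.exp_le_one_iff.mpr
      have : (0 : ℝ) ≤ deltaH 4 1 / N := by positivity
      have : (0 : ℝ) ≤ (supNorm (c - (N : ℤ) • u) : ℝ) := Nat.cast_nonneg _
      nlinarith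
    calc C * Real.exp (-(deltaH 4 1 / N) * (supNorm (c - (N : ℤ) • u) : ℝ)) ≤ C * 1 := mul_le_mul_of_nonneg_left h1 hC
      _ = C := mul_one C
  exact coarse_mix4_secondMoment_scl (N := N) hδ hN hp hrad hradR U W
    (I := fun c u => kerH (N - 1) a c u) (J := fun b v => kerH (N - 1) a b v)
    hI0 S V v₀ (fun b => hI b v₀) (fun b' => hJ' b' V)

end Summit.QuantumFields.BalabanUV.Beta.FP.GhostLoopCountingMixQuartic

end
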